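import Summits.CriticalPhenomena.CardyFormulaZ2.Theses.CardySelfRefinement
import Literature.Probability.RandomPlanarGeometry.SLEUniquenessInLaw

/-!
# Sketch (crux-ideate, ideator 3) — crux `SubseqUpgrade` (stmt-CriticalPhenomena-10279),
# route CardySelfRefinement

Idea `uniqueness-pin-subsequence`: the FIRST LEMMA is the model-independent subsequence
principle `convergesInLawToSLE_of_forall_seq_subseq` — if along every POSITIVE null sequence of
meshes some subsequence of the random curve classes `Y δ` converges (bounded-continuous test
functions) to SOME chordal SLE_κ law of `(D; a, b)`, then `Y δ` converges in law to chordal SLE_κ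
(`ConvergesInLawToSLE κ D Y P`).  Lever: `IsSLELaw.unique'` (tree, proved) pins every such limit
to the law of ONE SLE curve `Γ` extracted from the hypothesis itself (harmonic sequence), and
`Filter.tendsto_of_subseq_tendsto` on the countably generated filter `𝓝[>] 0` concludes, after an
index shift turning an eventually-positive sequence into a positive one.

The crux `SubseqUpgrade` is the specialisation `Y δ = bondInterfaceIn D (E δ)`,
`P δ = bondPercolation (zdGraph 2) half`, `μ = P_fam D` — its "one subsequence and one family for
all (D, E)" uniformity is not even needed (per-(D, E) subsequences suffice).
-/

open Filter Topology MeasureTheory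
open scoped NNReal BoundedContinuousFunction

namespace Summit.CriticalPhenomena.CardyFormulaZ2.Cruxes.SubseqUpgrade.SketchIdeator3

open Literature.Probability.RandomPlanarGeometry

/-- **First lemma (model-independent subsequence principle for convergence to SLE).**
If the random curve classes `Y δ` are eventually a.e.-measurable and along every positive null
sequence of meshes `s` some subsequence converges, against bounded continuous test functions, to
some chordal SLE_κ law in `(D; a, b)`, then `Y δ → SLE_κ` in law as `δ → 0⁺`.
Billingsley (1999), Thm. 2.6; Lawler (2005), §6.3 (uniqueness of the SLE law, tree theorem
`IsSLELaw.unique'`). -/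
theorem convergesInLawToSLE_of_forall_seq_subseq {κ : ℝ≥0} {D : DobrushinDomain}
    {Ωδ : ℝ → Type*} [∀ δ, MeasurableSpace (Ωδ δ)] {Y : ∀ δ, Ωδ δ → CurveClass ℂ}
    {P : ∀ δ, Measure (Ωδ δ)}
    (hY : ∀ᶠ δ in 𝓝[>] (0 : ℝ), AEMeasurable (Y δ) (P δ))
    (h : ∀ s : ℕ → ℝ, (∀ n, 0 < s n) → Tendsto s atTop (𝓝 0) →
      ∃ φ : ℕ → ℕ, StrictMono φ ∧ ∃ μ : Measure (CurveClass ℂ), IsSLELaw κ D μ ∧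
        ∀ f : CurveClass ℂ →ᵇ ℝ,
          Tendsto (fun n ↦ ∫ ω, f (Y (s (φ n)) ω) ∂P (s (φ n))) atTop (𝓝 (∫ x, f x ∂μ))) :
    ConvergesInLawToSLE κ D Y P := by
  -- Step 1: one SLE_κ random curve `Γ` in `D`, from the hypothesis along the harmonic sequence.
  obtain ⟨-, -, μ₀, ⟨Γ, hΓ, -⟩, -⟩ :=
    h (fun n ↦ 1 / ((n : ℝ) + 1)) (fun n ↦ Nat.one_div_pos_of_nat)
      tendsto_one_div_add_atTop_nhds_zero_nat
  refine ⟨Γ, hΓ, hY, fun f ↦ ?_⟩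
  -- Step 2: subsequence principle on the countably generated filter `𝓝[>] 0`.
  refine tendsto_of_subseq_tendsto fun s hs ↦ ?_
  have hs0 : Tendsto s atTop (𝓝 0) := tendsto_nhds_of_tendsto_nhdsWithin hs
  obtain ⟨N, hN⟩ := eventually_atTop.1 (tendsto_nhdsWithin_iff.1 hs).2
  -- Step 3: shift the index so that the sequence is positive, then apply the hypothesis.
  obtain ⟨φ, -, μ, hμ, hlim⟩ := h (fun n ↦ s (n + N)) (fun n ↦ hN _ (N.le_add_left n))
    (hs0.comp (tendsto_add_atTop_nat N))
  refine ⟨fun n ↦ φ n + N, ?_⟩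
  -- Step 4: the limit law is THE SLE_κ law of `(D; a, b)`, i.e. the law of `Γ`.
  have hμeq : μ = Literature.Probability.Process.preWienerMeasure.map Γ := hμ.unique' hΓ.isSLELaw_map
  have hl := hlim f
  rw [hμeq, integral_map hΓ.aemeasurable f.continuous.aestronglyMeasurable] at hl
  exact hl

open Summit.CriticalPhenomena.CardyFormulaZ2.Theses.CardySelfRefinement in
/-- **The crux follows** (specialisation to the bond-`ℤ²` interfaces; the single family `P_fam`
serving all `(D, E)` is used only through its component `P_fam D`). -/
theorem subseqUpgrade_holds : SubseqUpgrade := by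
  rintro ⟨hmeas, hsub⟩ D E hE
  refine convergesInLawToSLE_of_forall_seq_subseq (hmeas D E hE) fun s hs hs0 ↦ ?_
  obtain ⟨φ, hφ, Pfam, hP, hlim⟩ := hsub s hs hs0
  exact ⟨φ, hφ, Pfam D, hP D, hlim D E hE⟩

end Summit.CriticalPhenomena.CardyFormulaZ2.Cruxes.SubseqUpgrade.SketchIdeator3
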